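/-
Copyright (c) 2026 the pub-hodgecm-mathlib formalisation cell (harness21).  Prover seat hodgecm-mathlib-LD1-p02 (g4), FLOOR 0, programme P6,
half-A line LD1 of crux `hLiu418`, brick (Gα-C∞) `ArchLadder`, plate (P4) «ι-step», sub-brick (P4b) number-field half.  KERNEL module: THEOREMS
ONLY (no definition, no named fact, no `sorry`, no instance, no notation).
-/
import Literature.NumberTheory.GelbartRogawski1991.DoubledWeilRepresentationArchPlaceElement
import Literature.NumberTheory.Weil1964.ArchPlaceDiagBoost
import Literature.RepresentationTheory.KonnoKonno2007.JunctionHyperbolicReindex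
import HarnessLib

/-!
# The ONE-PLACE element `k_{v₀,u}` of the doubled unitary group at a BOOST `u` of a hyperbolic plane: its sign-frame components assemble to
# the junction boost `hypV`, and Folland's section there is a unimodular multiple of the transported hyperbolic family `hypOp`
# ([Folland1989, §4.2 (4.24), Prop. (4.39)]; [KonnoKonno2007, §3.1, §3.3]; [Kudla1994, §2])

Topic `NumberTheory/GelbartRogawski1991`; namespace `Literature.NumberTheory.GelbartRogawski1991.GRConstruction`.  KERNEL ONLY: proved theorems;
0 definitions, 0 records, 0 `sorry`.  Sibling of ★ `DoubledWeilRepresentationArchPlaceElement` §3 ∕ ★ `DoubledWeilRepresentationArchPlacePhase` (β-I), which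
read Folland's section `sectionD` of the doubled group at the one-place element `k_{v₀,u} = ((u at w(v₀)) ⊗ 1_W) ⊕ 1` for SIGN-BLOCK COMPACT `u` (the pair
form DEFINITE at `w(v₀)`).  Here `u ∈ U(σ_{w(v₀)} diag dV)(ℂ)` is a BOOST of ONE hyperbolic plane `{k₊, k₋}` of the pair space at an INDEFINITE place:
in the scaled Folland frame (`D = √|x_{v₀}|`) the matrix `D (u ⊗ 1_W)^e D⁻¹` is `!![ch t, −i sh t; i sh t, ch t]` on `{k₊, k₋}` (`x_{v₀}(k₊) > 0 > x_{v₀}(k₋)`)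
and the identity elsewhere (hypothesis `hu`).

* §1 **`archUFormPi_archKPlace_apply_signSplit`** — the entries of the sign-frame component `(archUFormPi k_{v₀,u})_v` at `(ε_v j, ε_v j′)`:
  `√|x_v(j)| · ((u)_{w(v)} ⊗ 1 ⊕ 1)^{e₂}_{j j′} · √|x_v(j′)|⁻¹` (★ `coe_archUForm`, ★ `coe_archAt_archKPlace`);
* §2 **`placeDiag_archUFormPi_archKPlace_eq_hypV`** — under `hu`, `placeDiag (archUFormPi k_{v₀,u}) = hypV ⟨v₀, e₂(inl k₊)⟩ ⟨v₀, e₂(inl k₋)⟩ t` in the big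
  junction `U(Σ_v Pos_v, Σ_v Neg_v)` (★ `UForm.placeDiag_eq_hypV_of_entries`);
* §3 **`sectionD_archKPlace_apply_of_boost`** — hence Folland's section at `k_{v₀,u}` acts on `𝓢(ℝ^{Fin (n+n) × places})` by
  `c • e_* (hypOp t (e_*⁻¹ f))`, `e = archIdx` (★ `archWeilSectionS_apply`, ★ P4a `weilHomV_hypV_eq_smul_hypOp`), with the EXPLICIT non-zero unimodular
  `c = C(weilHomV a_t) ∕ C(hypOp t)`.

HONEST SCOPE.  Statements about the tree's own Weil-representation terms; nothing of [Liu2021] is asserted; HC_CM is NOT proved here or anywhere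
in the tree.

References: [Folland1989] G. B. Folland, *Harmonic Analysis in Phase Space* (1989), §4.2 (4.24), Prop. (4.39), the Schur remark p. 156;
[KonnoKonno2007] K. Konno, T. Konno, Kyushu J. Math. 61 (2007), §3.1 (3.1), §3.3; [Kudla1994] S. Kudla, Israel J. Math. 87 (1994), §2;
[BorelJacquet1979] PSPM 33.1 §4.1.
-/

set_option autoImplicit false

noncomputable section

open scoped Classical
open scoped Matrix Kronecker
open Complex
open NumberField NumberField.InfinitePlace NumberField.mixedEmbedding IsDedekindDomain
open Literature.NumberTheory.Automorphic Literature.NumberTheory.Automorphic.UnitaryGroup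
open Literature.NumberTheory.Weil1964

/-! ## §0 Generic: Folland's section of `archWeilSectionS` when the sign-frame components assemble to a junction boost -/

namespace Literature.NumberTheory.Weil1964

section GenericBoost

open scoped Classical
open Literature.RepresentationTheory.KonnoKonno2007 Literature.RepresentationTheory.KonnoKonno2007.RealDualPair
open Literature.Analysis.SegalBargmann Literature.RepresentationTheory.HeisenbergGroup
open Literature.NumberTheory.Weil1964.MpS Literature.NumberTheory.Weil1964.UnitaryWeil

variable {F : Type} [Field F] [NumberField F] (E : Type) [Field E] [NumberField E] [Algebra F E] (c : E ≃ₐ[F] E)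
  (N : ℕ) (hc : c ≠ 1)
  (wOf : {v : InfinitePlace F // v.IsReal} → {w : InfinitePlace E // w.IsComplex})
  (hw : ∀ v, c • (wOf v).1 = (wOf v).1) (hover : ∀ v, (wOf v).1.comap (algebraMap F E) = v.1)
  (t₀ : Fin N → F) (ht0 : ∀ j, t₀ j ≠ 0) {T : Matrix (Fin N) (Fin N) F} (hTd : T = Matrix.diagonal t₀)
  {J : Matrix (Fin N) (Fin N) E} (hJ : J = T.map (algebraMap F E)) {δ : E} (hcδ : c δ = -δ) (hδ : δ ≠ 0)

set_option maxHeartbeats 2000000 in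
-- (instance unification between the junction's `Σ`-index `Fintype`/`DecidableEq` structures and the freshly synthesised ones is slow)
/-- **the archimedean section at an element whose components assemble to the junction boost `hypV P₀ Q₀ t`** acts on `𝓢(ℝ^{Fin N × places})` by
`c • e_* (hypOp t (e_*⁻¹ f))`, `e = archIdx`, `c = C(weilHomV a_t) ∕ C(hypOp t)` (★ `archWeilSectionS_apply`, ★ `MpS.reindex_apply`, ★ `weilHomV_hypV_apply`).
[cite: Folland1989, §4.2 (4.24), the Schur remark p. 156] [cite: KonnoKonno2007, §3.3] -/
theorem archWeilSectionS_apply_of_placeDiag_eq_hypV (g : UnitaryGroup.arch F E c N J)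
    (P₀ : Σ v, PosIdx (signVec wOf t₀ δ v)) (Q₀ : Σ v, NegIdx (signVec wOf t₀ δ v)) (t : ℝ)
    (hg : UForm.placeDiag (archUFormPi E c N hc wOf hw hover t₀ ht0 hTd hJ hcδ hδ g) = hypV P₀ Q₀ t)
    (f : SchwartzMap ((Fin N × {v : InfinitePlace F // v.IsReal}) → ℝ) ℂ) :
    (archWeilSectionS E c N hc wOf hw hover t₀ ht0 hTd hJ hcδ hδ g).1.2 f =
      (vac (weilHomV (Σ v, PosIdx (signVec wOf t₀ δ v)) (Σ v, NegIdx (signVec wOf t₀ δ v)) Unit Empty (hypV P₀ Q₀ t)) /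
          vacCoeffS (hypOp Unit Empty P₀ Q₀ t)) •
        schwartzTransport (reindexCLE (archIdx E N wOf t₀ (δ := δ)))
          (hypOp Unit Empty P₀ Q₀ t ((schwartzTransport (reindexCLE (archIdx E N wOf t₀ (δ := δ)))).symm f)) := by
  rw [archWeilSectionS_apply, MpS.reindex_apply, hg, weilHomV_hypV_apply, map_smul]
  -- (the two sides now differ only in the `Fintype`/`DecidableEq` instance terms of the `Σ`-index junction)
  rfl

end GenericBoost

end Literature.NumberTheory.Weil1964

namespace Literature.NumberTheory.GelbartRogawski1991.GRConstruction

open UnitaryDualPair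
open Literature.NumberTheory.GelbartRogawski1991.UnitaryDualPair.LocalSplitting
open Literature.RepresentationTheory.KonnoKonno2007 Literature.RepresentationTheory.KonnoKonno2007.RealDualPair
open Literature.Analysis.SegalBargmann Literature.RepresentationTheory.HeisenbergGroup
open Literature.NumberTheory.Weil1964.MpS Literature.NumberTheory.Weil1964.UnitaryWeil

variable (L : Type) [Field L] [NumberField L] [IsCMField L]

variable {N M n : ℕ} (e : Fin N × Fin M ≃ Fin n)
  (dV : Fin N → L) (hdV : ∀ i, IsCMField.complexConj L (dV i) = dV i) (hdV0 : ∀ i, dV i ≠ 0)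
  (dW : Fin M → L) (hdW : ∀ i, IsCMField.complexConj L (dW i) = dW i) (hdW0 : ∀ i, dW i ≠ 0)
  (v₀ : {v : InfinitePlace (Fp L) // v.IsReal})

/-! ## §1 The entries of the sign-frame components of `k_{v₀,u}` -/

include hdV0 hdW0 in
/-- **the entries of `(archUFormPi k_{v₀,u})_v` in the sign frame `ε_v = signSplit x_v`**: at `(ε_v j, ε_v j′)` the entry is
`√|x_v(j)| · (((u)_{w(v)} ⊗ 1_W)^e ⊕ 1)^{e₂}_{j j′} · √|x_v(j′)|⁻¹`, `(u)_{w(v)} = archAt (w(v)) (archSingle (w(v₀)) u)` (`u` at `v₀`, `1` elsewhere).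
[cite: KonnoKonno2007, §3.1 (3.1)] [cite: BorelJacquet1979, §4.1] -/
theorem archUFormPi_archKPlace_apply_signSplit (u : UnitaryGroup.archLocal L N (Matrix.diagonal dV) (cmPlaceOver L v₀))
    (v : {v : InfinitePlace (Fp L) // v.IsReal}) (j j' : Fin (n + n)) :
    (((archUFormPi L (IsCMField.complexConj L) (n + n) (IsCMField.complexConj_ne_one L) (cmPlaceOver L) (cmPlaceOver_smul L)
          (cmPlaceOver_comap L) (entryD L e dV hdV dW hdW) (gramD_gram_realDiagonal_entry_ne_zero L e dV hdV dW hdW hdV0 hdW0)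
          (gramD_eq_diagonal_cm L e dV hdV dW hdW) (J := hermD L e dV hdV dW hdW) rfl (complexConj_imagUnit L) (imagUnit_ne_zero L)
          (archKPlace L e dV hdV dW hdW v₀ u) v :
          UForm (PosIdx (signVec (cmPlaceOver L) (entryD L e dV hdV dW hdW) (imagUnit L) v))
            (NegIdx (signVec (cmPlaceOver L) (entryD L e dV hdV dW hdW) (imagUnit L) v))) :
          GL (PosIdx (signVec (cmPlaceOver L) (entryD L e dV hdV dW hdW) (imagUnit L) v) ⊕
            NegIdx (signVec (cmPlaceOver L) (entryD L e dV hdV dW hdW) (imagUnit L) v)) ℂ) :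
          Matrix _ _ ℂ)
        (signSplit (signVec (cmPlaceOver L) (entryD L e dV hdV dW hdW) (imagUnit L) v) j)
        (signSplit (signVec (cmPlaceOver L) (entryD L e dV hdV dW hdW) (imagUnit L) v) j') =
      ((sqrtAbs (signVec (cmPlaceOver L) (entryD L e dV hdV dW hdW) (imagUnit L) v) j : ℝ) : ℂ) *
        Matrix.reindex (e₂ (n := n)) (e₂ (n := n))
          (Matrix.fromBlocks
            (Matrix.reindex e e
              ((((UnitaryGroup.archAt (Fp L) L (IsCMField.complexConj L) N (Matrix.diagonal dV) (cmPlaceOver L v) (cmPlaceOver_smul L v)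
                  (IsCMField.complexConj_ne_one L)
                  (UnitaryGroup.archSingle (Fp L) L (IsCMField.complexConj L) N (Matrix.diagonal dV) (IsCMField.complexConj_ne_one L)
                    (complexConj_smul_infinitePlace L) (cmPlaceOver L v₀) u) :
                  UnitaryGroup.archLocal L N (Matrix.diagonal dV) (cmPlaceOver L v)) : GL (Fin N) ℂ) : Matrix (Fin N) (Fin N) ℂ) ⊗ₖ
                (1 : Matrix (Fin M) (Fin M) ℂ)))
            0 0 1) j j' *
        (((sqrtAbs (signVec (cmPlaceOver L) (entryD L e dV hdV dW hdW) (imagUnit L) v) j' : ℝ) : ℂ))⁻¹ := by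
  rw [archUFormPi_apply, coe_archUForm, Matrix.reindex_apply, Matrix.submatrix_apply, Equiv.symm_apply_apply, Equiv.symm_apply_apply,
    scaleConj_apply, UnitaryGroup.archPart_archToAdelic, coe_archAt_archKPlace]

/-! ## §2 The sign-frame components of `k_{v₀,u}` at a boost `u` assemble to the junction boost `hypV` -/

include hdV0 hdW0 in
/-- **THE ONE-PLACE BOOST IS THE JUNCTION BOOST.**  Let `k₊ k₋ : Fin n` be two coordinates of the pair space with `x_{v₀}(k₊) > 0`, `¬ x_{v₀}(k₋) > 0`, and let
`u ∈ U(σ_{w(v₀)} diag dV)(ℂ)` have scaled-frame matrix `D (u ⊗ 1_W)^e D⁻¹` equal to the boost `!![ch t, −i sh t; i sh t, ch t]` on `{k₊, k₋}` and to the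
identity elsewhere (`hu`).  Then the block assembly of the sign-frame components of `k_{v₀,u}` IS `hypV ⟨v₀, e₂(inl k₊)⟩ ⟨v₀, e₂(inl k₋)⟩ t` in the junction
`U(Σ_v Pos_v, Σ_v Neg_v)` of the doubled archimedean group (§1 + ★ `UForm.placeDiag_eq_hypV_of_entries`). [cite: KonnoKonno2007, §3.1 (3.1), §3.3]
[cite: Folland1989, §4.2 (4.24)] -/
theorem placeDiag_archUFormPi_archKPlace_eq_hypV (u : UnitaryGroup.archLocal L N (Matrix.diagonal dV) (cmPlaceOver L v₀)) (t : ℝ)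
    (kp km : Fin n)
    (Hp : 0 < signVec (cmPlaceOver L) (entryD L e dV hdV dW hdW) (imagUnit L) v₀ ((e₂ (n := n)) (Sum.inl kp)))
    (Hm : ¬0 < signVec (cmPlaceOver L) (entryD L e dV hdV dW hdW) (imagUnit L) v₀ ((e₂ (n := n)) (Sum.inl km)))
    (hu : ∀ i i' : Fin n,
      ((sqrtAbs (signVec (cmPlaceOver L) (cmGramEntry L e dV hdV dW hdW) (imagUnit L) v₀) i : ℝ) : ℂ) *
          Matrix.reindex e e
            ((((u : UnitaryGroup.archLocal L N (Matrix.diagonal dV) (cmPlaceOver L v₀)) : GL (Fin N) ℂ) : Matrix (Fin N) (Fin N) ℂ) ⊗ₖ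
              (1 : Matrix (Fin M) (Fin M) ℂ)) i i' *
          (((sqrtAbs (signVec (cmPlaceOver L) (cmGramEntry L e dV hdV dW hdW) (imagUnit L) v₀) i' : ℝ) : ℂ))⁻¹ =
        if i = kp then (if i' = kp then (Real.cosh t : ℂ) else if i' = km then -(Real.sinh t : ℂ) * I else 0)
        else if i = km then (if i' = kp then (Real.sinh t : ℂ) * I else if i' = km then (Real.cosh t : ℂ) else 0)
        else if i = i' then 1 else 0) :
    UForm.placeDiag (archUFormPi L (IsCMField.complexConj L) (n + n) (IsCMField.complexConj_ne_one L) (cmPlaceOver L) (cmPlaceOver_smul L)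
          (cmPlaceOver_comap L) (entryD L e dV hdV dW hdW) (gramD_gram_realDiagonal_entry_ne_zero L e dV hdV dW hdW hdV0 hdW0)
          (gramD_eq_diagonal_cm L e dV hdV dW hdW) (J := hermD L e dV hdV dW hdW) rfl (complexConj_imagUnit L) (imagUnit_ne_zero L)
          (archKPlace L e dV hdV dW hdW v₀ u)) =
      hypV (α := Σ v, PosIdx (signVec (cmPlaceOver L) (entryD L e dV hdV dW hdW) (imagUnit L) v))
        (β := Σ v, NegIdx (signVec (cmPlaceOver L) (entryD L e dV hdV dW hdW) (imagUnit L) v))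
        ⟨v₀, ⟨(e₂ (n := n)) (Sum.inl kp), Hp⟩⟩ ⟨v₀, ⟨(e₂ (n := n)) (Sum.inl km), Hm⟩⟩ t := by
  -- abbreviations for the two scale functions and the non-vanishing of the doubled one
  have hD0 : ∀ (v : {v : InfinitePlace (Fp L) // v.IsReal}) (j : Fin (n + n)),
      ((sqrtAbs (signVec (cmPlaceOver L) (entryD L e dV hdV dW hdW) (imagUnit L) v) j : ℝ) : ℂ) ≠ 0 := fun v j =>
    Complex.ofReal_ne_zero.mpr (sqrtAbs_signVec_ne_zero (IsCMField.complexConj_ne_one L) (cmPlaceOver_smul L) (complexConj_imagUnit L)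
      (imagUnit_ne_zero L) (gramD_gram_realDiagonal_entry_ne_zero L e dV hdV dW hdW hdV0 hdW0) v j)
  -- the doubled scale on the first copy is the pair scale
  have hDinl : ∀ i : Fin n, sqrtAbs (signVec (cmPlaceOver L) (entryD L e dV hdV dW hdW) (imagUnit L) v₀) ((e₂ (n := n)) (Sum.inl i)) =
      sqrtAbs (signVec (cmPlaceOver L) (cmGramEntry L e dV hdV dW hdW) (imagUnit L) v₀) i := fun i => by
    show Real.sqrt _ = Real.sqrt _
    rw [signVec_doubled_inl]
  have hkpm : kp ≠ km := fun h => Hm (h ▸ Hp)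
  -- the place component away from `v₀` is `1`, at `v₀` it is `u`
  have hself : UnitaryGroup.archAt (Fp L) L (IsCMField.complexConj L) N (Matrix.diagonal dV) (cmPlaceOver L v₀) (cmPlaceOver_smul L v₀)
        (IsCMField.complexConj_ne_one L)
        (UnitaryGroup.archSingle (Fp L) L (IsCMField.complexConj L) N (Matrix.diagonal dV) (IsCMField.complexConj_ne_one L)
          (complexConj_smul_infinitePlace L) (cmPlaceOver L v₀) u) = u :=
    UnitaryGroup.archAt_archSingle_self (Fp L) L (IsCMField.complexConj L) N (Matrix.diagonal dV) (IsCMField.complexConj_ne_one L)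
      (complexConj_smul_infinitePlace L) (cmPlaceOver L v₀) u
  have hne : ∀ v : {v : InfinitePlace (Fp L) // v.IsReal}, v ≠ v₀ →
      UnitaryGroup.archAt (Fp L) L (IsCMField.complexConj L) N (Matrix.diagonal dV) (cmPlaceOver L v) (cmPlaceOver_smul L v)
        (IsCMField.complexConj_ne_one L)
        (UnitaryGroup.archSingle (Fp L) L (IsCMField.complexConj L) N (Matrix.diagonal dV) (IsCMField.complexConj_ne_one L)
          (complexConj_smul_infinitePlace L) (cmPlaceOver L v₀) u) = 1 := fun v hv => by
    have hvw : cmPlaceOver L v ≠ cmPlaceOver L v₀ := fun h => hv (Subtype.ext (by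
      rw [← cmPlaceOver_comap L v, ← cmPlaceOver_comap L v₀, h]))
    exact UnitaryGroup.archAt_archSingle_of_ne (Fp L) L (IsCMField.complexConj L) N (Matrix.diagonal dV) (IsCMField.complexConj_ne_one L)
      (complexConj_smul_infinitePlace L) (cmPlaceOver L v₀) hvw u
  refine UForm.placeDiag_eq_hypV_of_entries (fun v => signVec (cmPlaceOver L) (entryD L e dV hdV dW hdW) (imagUnit L) v) v₀
    ((e₂ (n := n)) (Sum.inl kp)) ((e₂ (n := n)) (Sum.inl km)) Hp Hm t _ ?_ ?_ ?_ ?_ ?_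
  · -- identity entries off the plane / away from `v₀`
    intro v j j' hjj
    rw [archUFormPi_archKPlace_apply_signSplit L e dV hdV hdV0 dW hdW hdW0 v₀ u v j j']
    by_cases hv : v = v₀
    · subst hv
      rw [hself]
      obtain ⟨z, rfl⟩ := (e₂ (n := n)).surjective j
      obtain ⟨z', rfl⟩ := (e₂ (n := n)).surjective j'
      rw [Matrix.reindex_apply, Matrix.submatrix_apply, Equiv.symm_apply_apply, Equiv.symm_apply_apply]
      have hinj : ∀ a b : Fin n ⊕ Fin n, ((e₂ (n := n)) a = (e₂ (n := n)) b ↔ a = b) := fun a b => (e₂ (n := n)).injective.eq_iff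
      rcases z with i | i <;> rcases z' with i' | i'
      · rw [Matrix.fromBlocks_apply₁₁, hDinl, hDinl, hu i i']
        have hii : ((e₂ (n := n)) (Sum.inl i) = (e₂ (n := n)) (Sum.inl i')) = (i = i') :=
          propext ((hinj _ _).trans Sum.inl_injective.eq_iff)
        simp only [hii]
        rcases hjj with h | ⟨h1, h2⟩ | ⟨h1, h2⟩
        · exact absurd rfl h
        · rw [Ne, hinj, Sum.inl.injEq] at h1 h2
          rw [if_neg h1, if_neg h2]
        · rw [Ne, hinj, Sum.inl.injEq] at h1 h2
          by_cases hi : i = kp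
          · subst hi
            rw [if_pos rfl, if_neg h1, if_neg h2, if_neg (Ne.symm h1)]
          · rw [if_neg hi]
            by_cases hi' : i = km
            · subst hi'
              rw [if_pos rfl, if_neg h1, if_neg h2, if_neg (Ne.symm h2)]
            · rw [if_neg hi']
      · rw [Matrix.fromBlocks_apply₁₂, Matrix.zero_apply, mul_zero, zero_mul,
          if_neg (fun h => Sum.inl_ne_inr ((hinj _ _).1 h))]
      · rw [Matrix.fromBlocks_apply₂₁, Matrix.zero_apply, mul_zero, zero_mul,
          if_neg (fun h => Sum.inr_ne_inl ((hinj _ _).1 h))]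
      · by_cases hii : i = i'
        · subst hii
          rw [Matrix.fromBlocks_apply₂₂, Matrix.one_apply_eq, if_pos rfl, mul_one, mul_inv_cancel₀ (hD0 v _)]
        · rw [Matrix.fromBlocks_apply₂₂, Matrix.one_apply_ne hii, mul_zero, zero_mul,
            if_neg (fun h => hii (Sum.inr_injective ((hinj _ _).1 h)))]
    · rw [hne v hv, OneMemClass.coe_one, Units.val_one, Matrix.one_kronecker_one]
      simp only [Matrix.reindex_apply, Matrix.submatrix_one_equiv, Matrix.fromBlocks_one]
      by_cases hjj' : j = j'
      · subst hjj'
        rw [Matrix.one_apply_eq, if_pos rfl, mul_one, mul_inv_cancel₀ (hD0 v j)]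
      · rw [Matrix.one_apply_ne hjj', if_neg hjj', mul_zero, zero_mul]
  · -- `(k₊, k₊)`
    rw [archUFormPi_archKPlace_apply_signSplit L e dV hdV hdV0 dW hdW hdW0 v₀ u v₀, hself, Matrix.reindex_apply, Matrix.submatrix_apply,
      Equiv.symm_apply_apply, Matrix.fromBlocks_apply₁₁, hDinl, hu kp kp, if_pos rfl, if_pos rfl]
  · -- `(k₊, k₋)`
    rw [archUFormPi_archKPlace_apply_signSplit L e dV hdV hdV0 dW hdW hdW0 v₀ u v₀, hself, Matrix.reindex_apply, Matrix.submatrix_apply,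
      Equiv.symm_apply_apply, Equiv.symm_apply_apply, Matrix.fromBlocks_apply₁₁, hDinl, hDinl, hu kp km, if_pos rfl, if_neg hkpm.symm,
      if_pos rfl]
  · -- `(k₋, k₊)`
    rw [archUFormPi_archKPlace_apply_signSplit L e dV hdV hdV0 dW hdW hdW0 v₀ u v₀, hself, Matrix.reindex_apply, Matrix.submatrix_apply,
      Equiv.symm_apply_apply, Equiv.symm_apply_apply, Matrix.fromBlocks_apply₁₁, hDinl, hDinl, hu km kp, if_neg hkpm.symm, if_pos rfl,
      if_pos rfl]
  · -- `(k₋, k₋)`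
    rw [archUFormPi_archKPlace_apply_signSplit L e dV hdV hdV0 dW hdW hdW0 v₀ u v₀, hself, Matrix.reindex_apply, Matrix.submatrix_apply,
      Equiv.symm_apply_apply, Matrix.fromBlocks_apply₁₁, hDinl, hu km km, if_neg hkpm.symm, if_pos rfl, if_neg hkpm.symm, if_pos rfl]

/-! ## §3 Folland's section at the one-place boost is a unimodular multiple of the transported hyperbolic family -/

include hdV0 hdW0 in
set_option maxHeartbeats 2000000 in
-- (as in §0: instance unification along the junction relabelling is slow)
/-- **FOLLAND'S SECTION AT `k_{v₀,u}` FOR A BOOST `u`**: on `𝓢(ℝ^{Fin (n+n) × places})`,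
`sectionD (k_{v₀,u}) f = c • e_* (hypOp t (e_*⁻¹ f))` with `e = archIdx` (the sign-sorted junction relabelling of ★ `archWeilSectionS`), the junction's
hyperbolic family `hypOp` of the plane `(⟨v₀, e₂(inl k₊)⟩, ⟨v₀, e₂(inl k₋)⟩)` and the EXPLICIT non-zero unimodular scalar
`c = C(weilHomV a_t) ∕ C(hypOp t)` (★ `weilHomV_hypV_apply`; §2). [cite: Folland1989, §4.2 (4.24), the Schur remark p. 156] [cite: KonnoKonno2007, §3.3] -/
theorem sectionD_archKPlace_apply_of_boost (u : UnitaryGroup.archLocal L N (Matrix.diagonal dV) (cmPlaceOver L v₀)) (t : ℝ)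
    (kp km : Fin n)
    (Hp : 0 < signVec (cmPlaceOver L) (entryD L e dV hdV dW hdW) (imagUnit L) v₀ ((e₂ (n := n)) (Sum.inl kp)))
    (Hm : ¬0 < signVec (cmPlaceOver L) (entryD L e dV hdV dW hdW) (imagUnit L) v₀ ((e₂ (n := n)) (Sum.inl km)))
    (hu : ∀ i i' : Fin n,
      ((sqrtAbs (signVec (cmPlaceOver L) (cmGramEntry L e dV hdV dW hdW) (imagUnit L) v₀) i : ℝ) : ℂ) *
          Matrix.reindex e e
            ((((u : UnitaryGroup.archLocal L N (Matrix.diagonal dV) (cmPlaceOver L v₀)) : GL (Fin N) ℂ) : Matrix (Fin N) (Fin N) ℂ) ⊗ₖ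
              (1 : Matrix (Fin M) (Fin M) ℂ)) i i' *
          (((sqrtAbs (signVec (cmPlaceOver L) (cmGramEntry L e dV hdV dW hdW) (imagUnit L) v₀) i' : ℝ) : ℂ))⁻¹ =
        if i = kp then (if i' = kp then (Real.cosh t : ℂ) else if i' = km then -(Real.sinh t : ℂ) * I else 0)
        else if i = km then (if i' = kp then (Real.sinh t : ℂ) * I else if i' = km then (Real.cosh t : ℂ) else 0)
        else if i = i' then 1 else 0)
    (f : SchwartzMap ((Fin (n + n) × {v : InfinitePlace (Fp L) // v.IsReal}) → ℝ) ℂ) :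
    (sectionD L e dV hdV hdV0 dW hdW hdW0 (archKPlace L e dV hdV dW hdW v₀ u)).1.2 f =
      (vac (weilHomV (Σ v, PosIdx (signVec (cmPlaceOver L) (entryD L e dV hdV dW hdW) (imagUnit L) v))
              (Σ v, NegIdx (signVec (cmPlaceOver L) (entryD L e dV hdV dW hdW) (imagUnit L) v)) Unit Empty
              (hypV ⟨v₀, ⟨(e₂ (n := n)) (Sum.inl kp), Hp⟩⟩ ⟨v₀, ⟨(e₂ (n := n)) (Sum.inl km), Hm⟩⟩ t)) /
          vacCoeffS (hypOp Unit Empty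
            (⟨v₀, ⟨(e₂ (n := n)) (Sum.inl kp), Hp⟩⟩ : Σ v, PosIdx (signVec (cmPlaceOver L) (entryD L e dV hdV dW hdW) (imagUnit L) v))
            (⟨v₀, ⟨(e₂ (n := n)) (Sum.inl km), Hm⟩⟩ : Σ v, NegIdx (signVec (cmPlaceOver L) (entryD L e dV hdV dW hdW) (imagUnit L) v)) t)) •
        schwartzTransport (reindexCLE (archIdx L (n + n) (cmPlaceOver L) (entryD L e dV hdV dW hdW) (δ := imagUnit L)))
          (hypOp Unit Empty
            (⟨v₀, ⟨(e₂ (n := n)) (Sum.inl kp), Hp⟩⟩ : Σ v, PosIdx (signVec (cmPlaceOver L) (entryD L e dV hdV dW hdW) (imagUnit L) v))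
            (⟨v₀, ⟨(e₂ (n := n)) (Sum.inl km), Hm⟩⟩ : Σ v, NegIdx (signVec (cmPlaceOver L) (entryD L e dV hdV dW hdW) (imagUnit L) v)) t
            ((schwartzTransport (reindexCLE (archIdx L (n + n) (cmPlaceOver L) (entryD L e dV hdV dW hdW) (δ := imagUnit L)))).symm f)) := by
  exact archWeilSectionS_apply_of_placeDiag_eq_hypV L (IsCMField.complexConj L) (n + n) (IsCMField.complexConj_ne_one L) (cmPlaceOver L)
    (cmPlaceOver_smul L) (cmPlaceOver_comap L) (entryD L e dV hdV dW hdW) (gramD_gram_realDiagonal_entry_ne_zero L e dV hdV dW hdW hdV0 hdW0)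
    (gramD_eq_diagonal_cm L e dV hdV dW hdW) (J := hermD L e dV hdV dW hdW) rfl (complexConj_imagUnit L) (imagUnit_ne_zero L)
    (archKPlace L e dV hdV dW hdW v₀ u) _ _ t (placeDiag_archUFormPi_archKPlace_eq_hypV L e dV hdV hdV0 dW hdW hdW0 v₀ u t kp km Hp Hm hu) f

end Literature.NumberTheory.GelbartRogawski1991.GRConstruction

end
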